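import Summits.AtomisticToContinuum.HydrodynamicLimit.Theses.JParityClosure
import Literature.Analysis.FluidPDE.TorusPairReflection
import Literature.Analysis.FluidPDE.HardSpherePhaseSpaceProofs
import Literature.MathematicalPhysics.KineticTheory.HardSphereCampbellAssembly
import Literature.MathematicalPhysics.KineticTheory.HardSphereEulerProofs
import Literature.MathematicalPhysics.KineticTheory.MetropolisOddStatistic
import Summits.AtomisticToContinuum.HydrodynamicLimit.Theorems.JParityClosureOddContactSymmetryMetroMarkRegular
import HarnessLib

/-!
# Static tube parity of the Metropolis-odd mark on the Gibbs contact flux (`stub_fluxOddBound`, G1 of the line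
# `KineticSlabSketch` of the crux `JParityClosure.OddContactSymmetry`, stmt-AtomisticToContinuum-17722)

Piece G1 of the static centring S1a (lead c2, cycle 3).  GIVEN the invariance P3 of the Gibbs-weighted outgoing
contact flux under the pair reflection `J* = pairReflect i j (ε⁻¹ sepVec xᵢ xⱼ)` (`flux(ρ_G · F∘J*) = flux(ρ_G · F)`,
the neighbour stub `stub_fluxPairReflect`, a HYPOTHESIS here), the mark `m = metroOddMark σ N χ g Ψ r ϑ 0 =
χ(0, xᵢ) g(σ³ρ_r(xᵢ)) Ψ(n̂, pre) w₁` (`w₁ = min(1, e^{−F}) ∈ [0, 1]`) obeys `2 flux(ρ_G m⁺) ≤ 2 flux(ρ_G m⁻) +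
C_g C_Ψ ϖ flux(ρ_G) + 2 C_χ C_g C_Ψ flux(ρ_G (1 − w₁))` and symmetrically (`ϖ` = oscillation of `χ(0, ·)` over
minimal-image distance `2ε`): flux algebra in `ℝ≥0∞` (`two_mul_flux_ofReal_le_and`: P3 twice, additivity, the
pointwise `a⁺ + b⁺ ≤ a⁻ + b⁻ + |a + b|`, a CONTACT-LOCALISED monotonicity `outgoingCollisionFlux_mono_contact`) plus the
pointwise parity at contact `abs_metroOddMark_add_pairReflect_le` (`Ψ` flips sign under `J*`, `ρ_r(xᵢ)` is
`J*`-invariant, `χ`'s point moves by `≤ 2ε`, the Metropolis weights lie in `[0, 1]`).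
-/

noncomputable section

open scoped BigOperators Classical InnerProductSpace ENNReal Topology
open Set MeasureTheory Filter
open Literature.Analysis.FluidPDE Literature.MathematicalPhysics.KineticTheory

namespace Summit.AtomisticToContinuum.HydrodynamicLimit.Theorems.OddContactSymmetryKineticSlab

variable {d : Type*} [Fintype d] {n N : ℕ}

/-- Finite constants come out of the outgoing collision flux. [folklore] -/
theorem outgoingCollisionFlux_const_mul (ε : ℝ) (n : ℕ) {c : ℝ≥0∞} (hc : c ≠ ⊤)
    (g : Config n d (UnitAddTorus d) → Fin n → Fin n → ℝ≥0∞) :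
    outgoingCollisionFlux ε n (fun w i j => c * g w i j) = c * outgoingCollisionFlux ε n g := by
  unfold outgoingCollisionFlux
  rw [Finset.mul_sum]
  refine Finset.sum_congr rfl fun i _ => ?_
  rw [Finset.mul_sum]
  refine Finset.sum_congr rfl fun j _ => ?_
  split_ifs
  · exact (mul_zero c).symm
  · rw [← lintegral_const_mul' c _ hc]
    refine lintegral_congr fun z => ?_
    rw [← lintegral_const_mul' c _ hc]
    refine lintegral_congr fun ω => ?_
    rw [mul_left_comm]
    congr 1
    by_cases hD : contactInsert ε i j (ω : EuclideanSpace ℝ d) z ∈ hardSphereDomain (Torus.geometry d) n ε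
    · simp only [indicator_of_mem hD]
    · simp only [indicator_of_notMem hD, mul_zero]

/-- **Contact-localised monotonicity of the outgoing collision flux**: the flux only reads the mark on contact
configurations `contactInsert ε i j ω z` (`i ≠ j`, `‖ω‖ = 1`) lying in the hard-sphere domain, so a pointwise
inequality of the marks there suffices. [folklore] -/
theorem outgoingCollisionFlux_mono_contact (ε : ℝ) (n : ℕ)
    {g g' : Config n d (UnitAddTorus d) → Fin n → Fin n → ℝ≥0∞}
    (h : ∀ (i j : Fin n), i ≠ j → ∀ (ω : EuclideanSpace ℝ d), ‖ω‖ = 1 → ∀ z : Config n d (UnitAddTorus d),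
      contactInsert ε i j ω z ∈ hardSphereDomain (Torus.geometry d) n ε →
      g (contactInsert ε i j ω z) i j ≤ g' (contactInsert ε i j ω z) i j) :
    outgoingCollisionFlux ε n g ≤ outgoingCollisionFlux ε n g' := by
  unfold outgoingCollisionFlux
  refine Finset.sum_le_sum fun i _ => Finset.sum_le_sum fun j _ => ?_
  split_ifs with hij
  · exact le_rfl
  · refine lintegral_mono fun z => lintegral_mono fun ω => mul_le_mul' le_rfl ?_
    by_cases hD : contactInsert ε i j (ω : EuclideanSpace ℝ d) z ∈ hardSphereDomain (Torus.geometry d) n ε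
    · simp only [indicator_of_mem hD]
      exact h i j hij ω (mem_sphere_zero_iff_norm.1 ω.2) z hD
    · simp only [indicator_of_notMem hD, le_refl]

/-- For reals `a, b`: `a⁺ + b⁺ ≤ a⁻ + b⁻ + |a + b|` (since `a⁺ − a⁻ = a`), in `ℝ≥0∞`. [folklore] -/
theorem ofReal_add_ofReal_le (a b : ℝ) :
    ENNReal.ofReal a + ENNReal.ofReal b ≤
      ENNReal.ofReal (-a) + (ENNReal.ofReal (-b) + ENNReal.ofReal |a + b|) := by
  have hmax : ∀ x : ℝ, ENNReal.ofReal (max x 0) = ENNReal.ofReal x := fun x => by simp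
  rw [← hmax a, ← hmax b, ← hmax (-a), ← hmax (-b),
    ← ENNReal.ofReal_add (le_max_right _ _) (le_max_right _ _),
    ← ENNReal.ofReal_add (le_max_right _ _) (abs_nonneg _),
    ← ENNReal.ofReal_add (le_max_right _ _) (add_nonneg (le_max_right _ _) (abs_nonneg _))]
  refine ENNReal.ofReal_le_ofReal ?_
  linarith [max_zero_sub_max_neg_zero_eq_self a, max_zero_sub_max_neg_zero_eq_self b, le_abs_self (a + b)]

/-- **Abstract tube-parity bookkeeping on the outgoing collision flux.**  Let `ρ ≥ 0` be a measurable weight and `J` a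
measurable pair-indexed self-map of phase space leaving the `ρ`-weighted flux of every measurable mark invariant
(`flux(ρ · F∘J) = flux(ρ · F)`).  If a real measurable mark `m` satisfies, on the contact configurations of the flux,
`|m + m∘J| ≤ c₁ + c₂ (δ⁺ + δ⁺∘J)` for a measurable real mark `δ`, then `2 flux(ρ m^±) ≤ 2 flux(ρ m^∓) + c₁ flux(ρ) +
2 c₂ flux(ρ δ⁺)`: `2 flux(ρ m⁺) = flux(ρ (m⁺ + (m∘J)⁺)) ≤ flux(ρ (m⁻ + (m∘J)⁻ + |m + m∘J|)) = 2 flux(ρ m⁻) +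
flux(ρ |m + m∘J|)`, and the same for `−m`. [folklore] -/
theorem two_mul_flux_ofReal_le_and (ε : ℝ) (n : ℕ) (ρ : Config n d (UnitAddTorus d) → ℝ≥0∞)
    (J : Config n d (UnitAddTorus d) → Fin n → Fin n → Config n d (UnitAddTorus d))
    (m δ : Config n d (UnitAddTorus d) → Fin n → Fin n → ℝ) {c₁ c₂ : ℝ≥0∞} (hc₁ : c₁ ≠ ⊤) (hc₂ : c₂ ≠ ⊤)
    (hP3 : ∀ F : Config n d (UnitAddTorus d) → Fin n → Fin n → ℝ≥0∞, (∀ i j, Measurable fun w => F w i j) →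
      outgoingCollisionFlux ε n (fun w i j => ρ w * F (J w i j) i j) =
        outgoingCollisionFlux ε n (fun w i j => ρ w * F w i j))
    (hρ : Measurable ρ) (hm : ∀ i j, Measurable fun w => m w i j) (hδ : ∀ i j, Measurable fun w => δ w i j)
    (hJ : ∀ i j, Measurable fun w => J w i j)
    (hkey : ∀ (i j : Fin n), i ≠ j → ∀ (ω : EuclideanSpace ℝ d), ‖ω‖ = 1 → ∀ z : Config n d (UnitAddTorus d),
      contactInsert ε i j ω z ∈ hardSphereDomain (Torus.geometry d) n ε →
      ENNReal.ofReal |m (contactInsert ε i j ω z) i j + m (J (contactInsert ε i j ω z) i j) i j| ≤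
        c₁ + c₂ * (ENNReal.ofReal (δ (contactInsert ε i j ω z) i j) +
          ENNReal.ofReal (δ (J (contactInsert ε i j ω z) i j) i j))) :
    (2 * outgoingCollisionFlux ε n (fun w i j => ρ w * ENNReal.ofReal (m w i j)) ≤
      2 * outgoingCollisionFlux ε n (fun w i j => ρ w * ENNReal.ofReal (-m w i j)) +
        (c₁ * outgoingCollisionFlux ε n (fun w _ _ => ρ w) +
          (2 * c₂) * outgoingCollisionFlux ε n (fun w i j => ρ w * ENNReal.ofReal (δ w i j)))) ∧
    (2 * outgoingCollisionFlux ε n (fun w i j => ρ w * ENNReal.ofReal (-m w i j)) ≤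
      2 * outgoingCollisionFlux ε n (fun w i j => ρ w * ENNReal.ofReal (m w i j)) +
        (c₁ * outgoingCollisionFlux ε n (fun w _ _ => ρ w) +
          (2 * c₂) * outgoingCollisionFlux ε n (fun w i j => ρ w * ENNReal.ofReal (δ w i j)))) := by
  -- the one-sided statement for a general mark `m`; the second half is the first one for `−m`
  suffices one : ∀ m : Config n d (UnitAddTorus d) → Fin n → Fin n → ℝ, (∀ i j, Measurable fun w => m w i j) →
      (∀ (i j : Fin n), i ≠ j → ∀ (ω : EuclideanSpace ℝ d), ‖ω‖ = 1 → ∀ z : Config n d (UnitAddTorus d),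
        contactInsert ε i j ω z ∈ hardSphereDomain (Torus.geometry d) n ε →
        ENNReal.ofReal |m (contactInsert ε i j ω z) i j + m (J (contactInsert ε i j ω z) i j) i j| ≤
          c₁ + c₂ * (ENNReal.ofReal (δ (contactInsert ε i j ω z) i j) +
            ENNReal.ofReal (δ (J (contactInsert ε i j ω z) i j) i j))) →
      2 * outgoingCollisionFlux ε n (fun w i j => ρ w * ENNReal.ofReal (m w i j)) ≤
        2 * outgoingCollisionFlux ε n (fun w i j => ρ w * ENNReal.ofReal (-m w i j)) +
          (c₁ * outgoingCollisionFlux ε n (fun w _ _ => ρ w) +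
            (2 * c₂) * outgoingCollisionFlux ε n (fun w i j => ρ w * ENNReal.ofReal (δ w i j))) by
    refine ⟨one m hm hkey, ?_⟩
    have h := one (fun w i j => -m w i j) (fun i j => (hm i j).neg) fun i j hij ω hω z hDz => by
      rw [← neg_add, abs_neg]
      exact hkey i j hij ω hω z hDz
    simpa only [neg_neg] using h
  intro m hm hkey
  have hD : ∀ i j, Measurable fun w => ρ w * ENNReal.ofReal (δ w i j) :=
    fun i j => hρ.mul (hδ i j).ennreal_ofReal
  -- the error flux, read on contact configurations only, then P3 for `δ ∘ J`
  have hE : outgoingCollisionFlux ε n (fun w i j => ρ w * ENNReal.ofReal |m w i j + m (J w i j) i j|) ≤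
      c₁ * outgoingCollisionFlux ε n (fun w _ _ => ρ w) +
        (2 * c₂) * outgoingCollisionFlux ε n (fun w i j => ρ w * ENNReal.ofReal (δ w i j)) := by
    calc outgoingCollisionFlux ε n (fun w i j => ρ w * ENNReal.ofReal |m w i j + m (J w i j) i j|)
        ≤ outgoingCollisionFlux ε n (fun w i j => c₁ * ρ w +
            c₂ * (ρ w * ENNReal.ofReal (δ w i j) + ρ w * ENNReal.ofReal (δ (J w i j) i j))) := by
          refine outgoingCollisionFlux_mono_contact ε n fun i j hij ω hω z hDz => ?_
          calc ρ (contactInsert ε i j ω z) * ENNReal.ofReal |m (contactInsert ε i j ω z) i j +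
                m (J (contactInsert ε i j ω z) i j) i j|
              ≤ ρ (contactInsert ε i j ω z) * (c₁ + c₂ * (ENNReal.ofReal (δ (contactInsert ε i j ω z) i j) +
                  ENNReal.ofReal (δ (J (contactInsert ε i j ω z) i j) i j))) :=
                mul_le_mul' le_rfl (hkey i j hij ω hω z hDz)
            _ = _ := by ring
      _ = outgoingCollisionFlux ε n (fun w _ _ => c₁ * ρ w) +
            outgoingCollisionFlux ε n (fun w i j =>
              c₂ * (ρ w * ENNReal.ofReal (δ w i j) + ρ w * ENNReal.ofReal (δ (J w i j) i j))) :=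
          outgoingCollisionFlux_add ε n fun _ _ => hρ.const_mul c₁
      _ = _ := by
          rw [outgoingCollisionFlux_const_mul ε n hc₁, outgoingCollisionFlux_const_mul ε n hc₂,
            outgoingCollisionFlux_add ε n hD, hP3 (fun w i j => ENNReal.ofReal (δ w i j)) fun i j => (hδ i j).ennreal_ofReal]
          ring
  -- assembly: P3 for `m⁺ ∘ J` and `m⁻ ∘ J`, additivity, the pointwise `a⁺ + b⁺ ≤ a⁻ + b⁻ + |a + b|`
  have hB : ∀ i j, Measurable fun w => ρ w * ENNReal.ofReal (-m w i j) :=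
    fun i j => hρ.mul (hm i j).neg.ennreal_ofReal
  have hBJ : ∀ i j, Measurable fun w => ρ w * ENNReal.ofReal (-m (J w i j) i j) :=
    fun i j => hρ.mul ((hm i j).comp (hJ i j)).neg.ennreal_ofReal
  calc 2 * outgoingCollisionFlux ε n (fun w i j => ρ w * ENNReal.ofReal (m w i j))
      = outgoingCollisionFlux ε n (fun w i j => ρ w * ENNReal.ofReal (m w i j)) +
          outgoingCollisionFlux ε n (fun w i j => ρ w * ENNReal.ofReal (m (J w i j) i j)) := by
        rw [two_mul, hP3 (fun w i j => ENNReal.ofReal (m w i j)) fun i j => (hm i j).ennreal_ofReal]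
    _ = outgoingCollisionFlux ε n (fun w i j => ρ w * ENNReal.ofReal (m w i j) +
          ρ w * ENNReal.ofReal (m (J w i j) i j)) :=
        (outgoingCollisionFlux_add ε n fun i j => hρ.mul (hm i j).ennreal_ofReal).symm
    _ ≤ outgoingCollisionFlux ε n (fun w i j => ρ w * ENNReal.ofReal (-m w i j) +
          (ρ w * ENNReal.ofReal (-m (J w i j) i j) + ρ w * ENNReal.ofReal |m w i j + m (J w i j) i j|)) := by
        refine outgoingCollisionFlux_mono ε n fun w i j => ?_
        rw [← mul_add, ← mul_add, ← mul_add]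
        exact mul_le_mul' le_rfl (ofReal_add_ofReal_le _ _)
    _ = outgoingCollisionFlux ε n (fun w i j => ρ w * ENNReal.ofReal (-m w i j)) +
          (outgoingCollisionFlux ε n (fun w i j => ρ w * ENNReal.ofReal (-m w i j)) +
            outgoingCollisionFlux ε n (fun w i j => ρ w * ENNReal.ofReal |m w i j + m (J w i j) i j|)) := by
        rw [outgoingCollisionFlux_add ε n hB, outgoingCollisionFlux_add ε n hBJ,
          hP3 (fun w i j => ENNReal.ofReal (-m w i j)) fun i j => (hm i j).neg.ennreal_ofReal]
    _ ≤ outgoingCollisionFlux ε n (fun w i j => ρ w * ENNReal.ofReal (-m w i j)) +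
          (outgoingCollisionFlux ε n (fun w i j => ρ w * ENNReal.ofReal (-m w i j)) +
            (c₁ * outgoingCollisionFlux ε n (fun w _ _ => ρ w) +
              (2 * c₂) * outgoingCollisionFlux ε n (fun w i j => ρ w * ENNReal.ofReal (δ w i j)))) :=
        add_le_add le_rfl (add_le_add le_rfl hE)
    _ = _ := by ring

/-- **Factorisation of the Metropolis-odd mark**: `m = χ(s, xᵢ) · g(σ³ρ_r(xᵢ)) · Ψ(ε⁻¹ sep, pre) · w₁` with
`w₁ = metroOddMark σ N 1 1 1 …` the bare Metropolis weight `min(1, e^{−F})` (definitional). [folklore] -/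
theorem metroOddMark_factor (σ : ℝ) (χ : ℝ × UnitAddTorus (Fin 3) → ℝ) (g : ℝ → ℝ)
    (Ψ : V3 × V3 × V3 → ℝ) (r ϑ s : ℝ) (z : Config (N + 1) (Fin 3) T3) (i j : Fin (N + 1)) :
    metroOddMark σ N χ g Ψ r ϑ s z i j = χ (s, (z i).1) *
        g (σ ^ 3 * ∫ q, 3 / (Real.pi * r ^ 3) * max (1 - Torus.euclidDist q.1 (z i).1 / r) 0
          ∂(empiricalMeasure z)) *
        Ψ ((hsDiameter σ N)⁻¹ • (Torus.geometry (Fin 3)).sepVec (z i).1 (z j).1,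
          (reflectVel ((Torus.geometry (Fin 3)).sepVec (z i).1 (z j).1) ((z i).2, (z j).2)).1,
          (reflectVel ((Torus.geometry (Fin 3)).sepVec (z i).1 (z j).1) ((z i).2, (z j).2)).2) *
        metroOddMark σ N (fun _ => 1) (fun _ => 1) (fun _ => 1) r ϑ s z i j := by
  dsimp only [metroOddMark]
  ring

/-- The bare Metropolis weight `metroOddMark σ N 1 1 1 … = min(1, e^{−F})` is at most `1`. [folklore] -/
theorem metroOddMark_one_le_one (σ : ℝ) (r ϑ s : ℝ) (z : Config (N + 1) (Fin 3) T3) (i j : Fin (N + 1)) :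
    metroOddMark σ N (fun _ => 1) (fun _ => 1) (fun _ => 1) r ϑ s z i j ≤ 1 := by
  dsimp only [metroOddMark]
  rw [one_mul, one_mul, one_mul]
  exact minWeight_le_one _

/-- **The cone-mollified empirical density at `xᵢ` is invariant under the pair reflection**: it is a finite average of
cone kernels of the minimal-image distances `dist(x_k, x_i)`, all preserved by the point reflection about `x_j`
(`euclidDist_pairReflect`). [folklore] -/
theorem mollDensity_pairReflect (r : ℝ) (i j : Fin (N + 1)) (ω : V3) (z : Config (N + 1) (Fin 3) T3) :
    ∫ q, 3 / (Real.pi * r ^ 3) * max (1 - Torus.euclidDist q.1 (pairReflect i j ω z i).1 / r) 0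
        ∂(empiricalMeasure (pairReflect i j ω z)) =
      ∫ q, 3 / (Real.pi * r ^ 3) * max (1 - Torus.euclidDist q.1 (z i).1 / r) 0 ∂(empiricalMeasure z) := by
  rw [integral_empiricalMeasure, integral_empiricalMeasure]
  congr 1
  refine Finset.sum_congr rfl fun k _ => ?_
  rw [euclidDist_pairReflect]

/-- **The reflected partner stays within `2ε`**: if the pair `(i, j)` is in contact, `sepVec xᵢ xⱼ = εω` (`ε ≥ 0`,
`‖ω‖ = 1`), then `xᵢ = xⱼ + εω` and its image `xⱼ − εω` under the pair reflection are at minimal-image distance at most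
`‖2εω‖ = 2ε` (`Torus.euclidDist_proj_le_norm_sub`). [folklore] -/
theorem euclidDist_pairReflect_le_of_contact {ε : ℝ} (hε : 0 ≤ ε) (i j : Fin (N + 1)) {ω : V3} (hω : ‖ω‖ = 1)
    (ω' : V3) (w : Config (N + 1) (Fin 3) T3) (h : (Torus.geometry (Fin 3)).sepVec (w i).1 (w j).1 = ε • ω) :
    Torus.euclidDist (w i).1 (pairReflect i j ω' w i).1 ≤ 2 * ε := by
  rw [Torus.geometry_sepVec] at h
  have hx : (w i).1 - (w j).1 = Literature.Analysis.FunctionSpaces.Torus.proj (ε • ω) := by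
    rw [← h, Torus.proj_reprSym]
  have hdiff : (w i).1 - ((w j).1 + ((w j).1 - (w i).1)) = Literature.Analysis.FunctionSpaces.Torus.proj
      (ε • ω + ε • ω) - Literature.Analysis.FunctionSpaces.Torus.proj 0 := by
    rw [Literature.Analysis.FunctionSpaces.Torus.proj_add, ← hx, Literature.Analysis.FunctionSpaces.Torus.proj_zero]
    abel
  rw [pairReflect_fst, Torus.euclidDist_eq, hdiff, ← Torus.euclidDist_eq]
  calc _ ≤ ‖ε • ω + ε • ω - 0‖ := Torus.euclidDist_proj_le_norm_sub_holds _ _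
    _ = 2 * ε := by
      rw [sub_zero, ← two_smul ℝ (ε • ω), norm_smul, norm_smul, hω, Real.norm_of_nonneg hε, Real.norm_two, mul_one]

/-- Elementary: `|A G P W + A' G (−P) W'| ≤ C_g C_Ψ ϖ + C_χ C_g C_Ψ ((1 − W) + (1 − W'))` when `|A|, |A'| ≤ C_χ`,
`|A − A'| ≤ ϖ`, `|G| ≤ C_g`, `|P| ≤ C_Ψ`, `W, W' ≤ 1` (`A W − A' W' = (A − A') − A (1 − W) + A' (1 − W')`).
[folklore] -/
theorem abs_weightedPair_le {A A' G P W W' ϖ Cχ Cg CΨ : ℝ} (hA : |A| ≤ Cχ) (hA' : |A'| ≤ Cχ)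
    (hAA' : |A - A'| ≤ ϖ) (hG : |G| ≤ Cg) (hP : |P| ≤ CΨ) (hW1 : W ≤ 1) (hW1' : W' ≤ 1) :
    |A * G * P * W + A' * G * -P * W'| ≤ Cg * CΨ * ϖ + Cχ * Cg * CΨ * ((1 - W) + (1 - W')) := by
  have key : A * G * P * W + A' * G * -P * W' = G * P * ((A - A') - A * (1 - W) + A' * (1 - W')) := by ring
  rw [key, abs_mul, abs_mul]
  have h1 : |(A - A') - A * (1 - W) + A' * (1 - W')| ≤ ϖ + Cχ * (1 - W) + Cχ * (1 - W') := by
    refine (abs_add_le _ _).trans (add_le_add ((abs_sub _ _).trans (add_le_add hAA' ?_)) ?_)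
    · rw [abs_mul, abs_of_nonneg (sub_nonneg.2 hW1)]
      exact mul_le_mul_of_nonneg_right hA (sub_nonneg.2 hW1)
    · rw [abs_mul, abs_of_nonneg (sub_nonneg.2 hW1')]
      exact mul_le_mul_of_nonneg_right hA' (sub_nonneg.2 hW1')
  have hCg : 0 ≤ Cg := (abs_nonneg _).trans hG
  have hCΨ : 0 ≤ CΨ := (abs_nonneg _).trans hP
  calc |G| * |P| * |(A - A') - A * (1 - W) + A' * (1 - W')| ≤ Cg * CΨ * (ϖ + Cχ * (1 - W) + Cχ * (1 - W')) :=
        mul_le_mul (mul_le_mul hG hP (abs_nonneg _) hCg) h1 (abs_nonneg _) (mul_nonneg hCg hCΨ)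
    _ = _ := by ring

/-- **Pointwise tube parity of the Metropolis-odd mark at contact.**  For `0 < σ < 1/2`, a pair `(i, j)` (`i ≠ j`) in
contact, `sepVec xᵢ xⱼ = εω` (`ε = hsDiameter σ N`, `‖ω‖ = 1`), and `w' = J* w` the pair-reflected configuration read with
the configuration's own impact direction `ε⁻¹ sepVec xᵢ xⱼ = ω`: `m(w') = −χ(0, xᵢ′) g(σ³ρ_r(xᵢ)) Ψ(n̂, pre) w₁′`
(`oddMark_pairReflect_of_contact`, `mollDensity_pairReflect`) with `dist(xᵢ, xᵢ′) ≤ 2ε`, hence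
`|m(w) + m(w')| ≤ C_g C_Ψ ϖ + C_χ C_g C_Ψ ((1 − w₁) + (1 − w₁′))`. [folklore] -/
theorem abs_metroOddMark_add_pairReflect_le {σ : ℝ} (hσ : 0 < σ) (hσ2 : σ < 1 / 2)
    {χ : ℝ × UnitAddTorus (Fin 3) → ℝ} {g : ℝ → ℝ} {Ψ : V3 × V3 × V3 → ℝ} {r ϑ ϖ Cχ Cg CΨ : ℝ}
    (hχ : ∀ p, |χ p| ≤ Cχ) (hg : ∀ a, |g a| ≤ Cg) (hΨ : ∀ q, |Ψ q| ≤ CΨ)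
    (hmod : ∀ x y : UnitAddTorus (Fin 3), Torus.euclidDist x y ≤ 2 * hsDiameter σ N → |χ (0, x) - χ (0, y)| ≤ ϖ)
    (hΨodd : ∀ (n v w : V3), ‖n‖ = 1 → Ψ (-n, (reflectVel n (v, w)).1, (reflectVel n (v, w)).2) = -Ψ (n, v, w))
    {i j : Fin (N + 1)} (hij : i ≠ j) {ω : V3} (hω : ‖ω‖ = 1) (w : Config (N + 1) (Fin 3) T3)
    (h : (Torus.geometry (Fin 3)).sepVec (w i).1 (w j).1 = hsDiameter σ N • ω) :
    |metroOddMark σ N χ g Ψ r ϑ 0 w i j +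
        metroOddMark σ N χ g Ψ r ϑ 0
          (pairReflect i j ((hsDiameter σ N)⁻¹ • (Torus.geometry (Fin 3)).sepVec (w i).1 (w j).1) w) i j| ≤
      Cg * CΨ * ϖ + Cχ * Cg * CΨ *
        ((1 - metroOddMark σ N (fun _ => 1) (fun _ => 1) (fun _ => 1) r ϑ 0 w i j) +
          (1 - metroOddMark σ N (fun _ => 1) (fun _ => 1) (fun _ => 1) r ϑ 0
            (pairReflect i j ((hsDiameter σ N)⁻¹ • (Torus.geometry (Fin 3)).sepVec (w i).1 (w j).1) w) i j)) := by
  have hε0 : 0 < hsDiameter σ N := hsDiameter_pos hσ N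
  have hε2 : hsDiameter σ N < 1 / 2 := (hsDiameter_le hσ.le N).trans_lt hσ2
  have hJ : (hsDiameter σ N)⁻¹ • (Torus.geometry (Fin 3)).sepVec (w i).1 (w j).1 = ω := by
    rw [h, smul_smul, inv_mul_cancel₀ hε0.ne', one_smul]
  rw [hJ, metroOddMark_factor σ χ g Ψ r ϑ 0 w, metroOddMark_factor σ χ g Ψ r ϑ 0 (pairReflect i j ω w),
    mollDensity_pairReflect, oddMark_pairReflect_of_contact hij hε0 hε2 hω Ψ hΨodd w h]
  exact abs_weightedPair_le (hχ _) (hχ _) (hmod _ _ (euclidDist_pairReflect_le_of_contact hε0.le i j hω ω w h))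
    (hg _) (hΨ _) (metroOddMark_one_le_one σ r ϑ 0 w i j) (metroOddMark_one_le_one σ r ϑ 0 _ i j)

/-- The pair reflection read with the impact direction `ε⁻¹ sepVec xᵢ xⱼ` of the configuration itself is a measurable
self-map of phase space. [folklore] -/
theorem measurable_pairReflect_sepVec (ε : ℝ) (i j : Fin (N + 1)) :
    Measurable fun w : Config (N + 1) (Fin 3) T3 =>
      pairReflect i j (ε⁻¹ • (Torus.geometry (Fin 3)).sepVec (w i).1 (w j).1) w := by
  have hsub : Measurable fun w : Config (N + 1) (Fin 3) T3 => (w i).1 - (w j).1 := by fun_prop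
  have hn : Measurable fun w : Config (N + 1) (Fin 3) T3 =>
      ε⁻¹ • (Torus.geometry (Fin 3)).sepVec (w i).1 (w j).1 := by
    simp only [Torus.geometry_sepVec]
    exact (measurable_reprSym_comp hsub).const_smul ε⁻¹
  have hp : Measurable fun w : Config (N + 1) (Fin 3) T3 => ((w i).2, (w j).2) := by fun_prop
  have hR := measurable_reflectVel_comp hn hp
  refine measurable_pi_lambda _ fun k => ?_
  unfold pairReflect
  refine Measurable.prodMk ?_ ?_
  · fun_prop
  · by_cases hki : k = i
    · simpa only [if_pos hki] using hR.fst
    · by_cases hkj : k = j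
      · simpa only [if_neg hki, if_pos hkj] using hR.snd
      · simp only [if_neg hki, if_neg hkj]
        fun_prop

/-- **G1 `stub_fluxOddBound` — static tube parity of the Metropolis-odd mark on the Gibbs contact flux, from P3.**
For a time-frozen weight `χ` with `|χ(0,x) − χ(0,y)| ≤ ϖ` whenever `dist(x,y) ≤ 2ε`, bounded continuous `g, Ψ` with
`Ψ` J-odd, and the mark `m = metroOddMark σ N χ g Ψ r ϑ 0` (`m = χ(xᵢ) g(σ³ρ_r(xᵢ)) Ψ(n̂, pre) · w₁`):
`2·flux(ρ_G m⁺) ≤ 2·flux(ρ_G m⁻) + C_gC_Ψ ϖ·flux(ρ_G) + 2C_χC_gC_Ψ·flux(ρ_G (1 − w₁))` and symmetrically, given the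
invariance P3 of the Gibbs-weighted flux under the pair reflection (`two_mul_flux_ofReal_le_and` with the pointwise
bound `abs_metroOddMark_add_pairReflect_le` on contact configurations `contactInsert ε i j ω z`, `sepVec = εω`).
[folklore] -/
theorem stub_fluxOddBound :
    (∀ {σ : ℝ} (_hσ : 0 < σ) (_hσ2 : σ < 1 / 2) {θ : ℝ} (_hθ : 0 < θ) (a : ℝ) (u : V3) (N : ℕ)
      {F : Config (N + 1) (Fin 3) T3 → Fin (N + 1) → Fin (N + 1) → ℝ≥0∞} (_hF : ∀ i j, Measurable fun w => F w i j),
      outgoingCollisionFlux (hsDiameter σ N) (N + 1)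
          (fun w i j => ENNReal.ofReal (canonicalDensity (Torus.geometry (Fin 3)) (hsDiameter σ N) (N + 1)
            (localGibbsProfile (fun _ => a) (fun _ => u) (fun _ => θ)) w) *
            F (pairReflect i j ((hsDiameter σ N)⁻¹ • (Torus.geometry (Fin 3)).sepVec (w i).1 (w j).1) w) i j) =
        outgoingCollisionFlux (hsDiameter σ N) (N + 1)
          (fun w i j => ENNReal.ofReal (canonicalDensity (Torus.geometry (Fin 3)) (hsDiameter σ N) (N + 1)
            (localGibbsProfile (fun _ => a) (fun _ => u) (fun _ => θ)) w) * F w i j)) →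
    ∀ {σ : ℝ} (_hσ : 0 < σ) (_hσ4 : σ < 1 / 4) {θ : ℝ} (_hθ : 0 < θ) (N : ℕ)
    {χ : ℝ × UnitAddTorus (Fin 3) → ℝ} {g : ℝ → ℝ} {Ψ : V3 × V3 × V3 → ℝ} {r ϑ ϖ Cχ Cg CΨ : ℝ}
    (_hχc : Continuous χ) (_hgc : Continuous g) (_hΨc : Continuous Ψ) (_hr : 0 < r) (_hϑ : 0 < ϑ)
    (_hχ : ∀ p, |χ p| ≤ Cχ) (_hg : ∀ a, |g a| ≤ Cg) (_hΨ : ∀ q, |Ψ q| ≤ CΨ) (_hϖ : 0 ≤ ϖ)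
    (_hmod : ∀ x y : UnitAddTorus (Fin 3), Torus.euclidDist x y ≤ 2 * hsDiameter σ N → |χ (0, x) - χ (0, y)| ≤ ϖ)
    (_hΨodd : ∀ (n v w : V3), ‖n‖ = 1 → Ψ (-n, (reflectVel n (v, w)).1, (reflectVel n (v, w)).2) = -Ψ (n, v, w)),
    2 * outgoingCollisionFlux (hsDiameter σ N) (N + 1)
          (fun w i j => ENNReal.ofReal (canonicalDensity (Torus.geometry (Fin 3)) (hsDiameter σ N) (N + 1)
              (localGibbsProfile (fun _ => 1) (fun _ => 0) (fun _ => θ)) w) *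
            ENNReal.ofReal (metroOddMark σ N χ g Ψ r ϑ 0 w i j)) ≤
        2 * outgoingCollisionFlux (hsDiameter σ N) (N + 1)
          (fun w i j => ENNReal.ofReal (canonicalDensity (Torus.geometry (Fin 3)) (hsDiameter σ N) (N + 1)
              (localGibbsProfile (fun _ => 1) (fun _ => 0) (fun _ => θ)) w) *
            ENNReal.ofReal (-metroOddMark σ N χ g Ψ r ϑ 0 w i j)) +
        (ENNReal.ofReal (Cg * CΨ * ϖ) * outgoingCollisionFlux (hsDiameter σ N) (N + 1)
          (fun w _ _ => ENNReal.ofReal (canonicalDensity (Torus.geometry (Fin 3)) (hsDiameter σ N) (N + 1)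
              (localGibbsProfile (fun _ => 1) (fun _ => 0) (fun _ => θ)) w)) +
         ENNReal.ofReal (2 * Cχ * Cg * CΨ) * outgoingCollisionFlux (hsDiameter σ N) (N + 1)
          (fun w i j => ENNReal.ofReal (canonicalDensity (Torus.geometry (Fin 3)) (hsDiameter σ N) (N + 1)
              (localGibbsProfile (fun _ => 1) (fun _ => 0) (fun _ => θ)) w) *
            ENNReal.ofReal (1 - metroOddMark σ N (fun _ => 1) (fun _ => 1) (fun _ => 1) r ϑ 0 w i j))) ∧
    2 * outgoingCollisionFlux (hsDiameter σ N) (N + 1)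
          (fun w i j => ENNReal.ofReal (canonicalDensity (Torus.geometry (Fin 3)) (hsDiameter σ N) (N + 1)
              (localGibbsProfile (fun _ => 1) (fun _ => 0) (fun _ => θ)) w) *
            ENNReal.ofReal (-metroOddMark σ N χ g Ψ r ϑ 0 w i j)) ≤
        2 * outgoingCollisionFlux (hsDiameter σ N) (N + 1)
          (fun w i j => ENNReal.ofReal (canonicalDensity (Torus.geometry (Fin 3)) (hsDiameter σ N) (N + 1)
              (localGibbsProfile (fun _ => 1) (fun _ => 0) (fun _ => θ)) w) *
            ENNReal.ofReal (metroOddMark σ N χ g Ψ r ϑ 0 w i j)) +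
        (ENNReal.ofReal (Cg * CΨ * ϖ) * outgoingCollisionFlux (hsDiameter σ N) (N + 1)
          (fun w _ _ => ENNReal.ofReal (canonicalDensity (Torus.geometry (Fin 3)) (hsDiameter σ N) (N + 1)
              (localGibbsProfile (fun _ => 1) (fun _ => 0) (fun _ => θ)) w)) +
         ENNReal.ofReal (2 * Cχ * Cg * CΨ) * outgoingCollisionFlux (hsDiameter σ N) (N + 1)
          (fun w i j => ENNReal.ofReal (canonicalDensity (Torus.geometry (Fin 3)) (hsDiameter σ N) (N + 1)
              (localGibbsProfile (fun _ => 1) (fun _ => 0) (fun _ => θ)) w) *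
            ENNReal.ofReal (1 - metroOddMark σ N (fun _ => 1) (fun _ => 1) (fun _ => 1) r ϑ 0 w i j))) := by
  intro hP3 σ hσ hσ4 θ hθ N χ g Ψ r ϑ ϖ Cχ Cg CΨ hχc hgc hΨc _ _ hχ hg hΨ hϖ hmod hΨodd
  have hσ2 : σ < 1 / 2 := by linarith
  have hε0 : 0 < hsDiameter σ N := hsDiameter_pos hσ N
  have hε2 : hsDiameter σ N < 1 / 2 := (hsDiameter_le hσ.le N).trans_lt hσ2
  have hCχ : 0 ≤ Cχ := (abs_nonneg _).trans (hχ (0, 0))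
  have hCg : 0 ≤ Cg := (abs_nonneg _).trans (hg 0)
  have hCΨ : 0 ≤ CΨ := (abs_nonneg _).trans (hΨ 0)
  have h2c : ENNReal.ofReal (2 * Cχ * Cg * CΨ) = 2 * ENNReal.ofReal (Cχ * Cg * CΨ) := by
    rw [mul_assoc 2, mul_assoc 2, ENNReal.ofReal_mul zero_le_two, ENNReal.ofReal_ofNat]
  rw [h2c]
  refine two_mul_flux_ofReal_le_and (hsDiameter σ N) (N + 1)
    (fun w => ENNReal.ofReal (canonicalDensity (Torus.geometry (Fin 3)) (hsDiameter σ N) (N + 1)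
      (localGibbsProfile (fun _ => 1) (fun _ => 0) (fun _ => θ)) w))
    (fun w i j => pairReflect i j ((hsDiameter σ N)⁻¹ • (Torus.geometry (Fin 3)).sepVec (w i).1 (w j).1) w)
    (fun w i j => metroOddMark σ N χ g Ψ r ϑ 0 w i j)
    (fun w i j => 1 - metroOddMark σ N (fun _ => 1) (fun _ => 1) (fun _ => 1) r ϑ 0 w i j)
    ENNReal.ofReal_ne_top ENNReal.ofReal_ne_top (fun F hF => hP3 hσ hσ2 hθ 1 0 N hF)
    (measurable_canonicalDensity _ _
      (measurable_localGibbsProfile continuous_const continuous_const continuous_const)).ennreal_ofReal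
    (fun i j => measurable_metroOddMark σ N hχc hgc hΨc r ϑ 0 i j)
    (fun i j => measurable_const.sub
      (measurable_metroOddMark σ N continuous_const continuous_const continuous_const r ϑ 0 i j))
    (fun i j => measurable_pairReflect_sepVec (hsDiameter σ N) i j) fun i j hij ω hω z _ => ?_
  -- the pointwise bound at the contact configuration `contactInsert ε i j ω z`, moved to `ℝ≥0∞`
  have hd := sub_nonneg.2 (metroOddMark_one_le_one σ r ϑ 0 (contactInsert (hsDiameter σ N) i j ω z) i j)
  have hd' := sub_nonneg.2 (metroOddMark_one_le_one σ r ϑ 0 (pairReflect i j ((hsDiameter σ N)⁻¹ •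
    (Torus.geometry (Fin 3)).sepVec (contactInsert (hsDiameter σ N) i j ω z i).1
      (contactInsert (hsDiameter σ N) i j ω z j).1) (contactInsert (hsDiameter σ N) i j ω z)) i j)
  rw [← ENNReal.ofReal_add hd hd', ← ENNReal.ofReal_mul (by positivity),
    ← ENNReal.ofReal_add (by positivity) (mul_nonneg (by positivity) (add_nonneg hd hd'))]
  exact ENNReal.ofReal_le_ofReal (abs_metroOddMark_add_pairReflect_le hσ hσ2 hχ hg hΨ hmod hΨodd hij hω _
    (sepVec_contactInsert hε0.le hε2 hij hω.le z))

end Summit.AtomisticToContinuum.HydrodynamicLimit.Theorems.OddContactSymmetryKineticSlab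

end
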